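import Summits.AtomisticToContinuum.Crystallization.Theorems.FrustratedLawDichotomyStrainedPatchHomEntryLeafHTA2F

/-!
# K1-v2 kernel, SHARED LABEL RECORDS: the second-order affine slope constant computed from ONE list of per-label records (definitionally equal to the fast array)
# (27623 `(H) HomFloor (1/625)`, hcp half; hand-1 g34 FINDING §4)

decomp-a2c hand-1 g34 (crux `AperiodicFrustratedLawGap`, stmt-AtomisticToContinuum-27623).  Kernel-cost device only: `…Affine2Fast.QarrLJA2F` still re-derives the
label record `recLJ c w' b` (square root, division, LJ triples) inside each of its `351` accumulations.  Here the records are computed ONCE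
(`recsA2 = Lc.map (labA2 …)`) and every accumulation folds over that shared list (`T0L/W1L/W2L/QarrL/resQL/quadVec2L/quadL2L/slopeGsLJA2L`); the values are
PROVABLY EQUAL to the fast-array ones (`…_eq` lemmas by `List.map_map`), so `htCertSideA2F p J c w = htCertSideA2L p J c w` (★ `htCertSideA2F_eq_L`) and a
kernel `decide` on the `L` form certifies the `F` form that `…HomEntryLeafHTA2F.entryLeafOKHT4A2F_sound` consumes.

Kernel definitions + definitional equalities; 0 sorry; standard axioms; no instances / notation / `#eval`.  `--supports stmt-AtomisticToContinuum-27623`.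
-/

noncomputable section

namespace Summit.AtomisticToContinuum.Crystallization.Theorems.FrustratedLawDichotomyStrainedPatchHomEntryLeafHT

open Literature.Analysis.ValidatedNumerics.Numerics
open Literature.Analysis.ValidatedNumerics.IntervalGershgorin (lsum)
open Summit.AtomisticToContinuum.Crystallization.Theorems.FrustratedLawDichotomyStrainedPatchHomCurvKit (accFI)
open Summit.AtomisticToContinuum.Crystallization.Theorems.FrustratedLawDichotomyStrainedPatchHomCurvCentreKit
open Summit.AtomisticToContinuum.Crystallization.Theorems.FrustratedLawDichotomyStrainedPatchHomCurvLJ (recLJ ljLabelOK naiveLJ curvCheckLJM)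
open Summit.AtomisticToContinuum.Crystallization.Theorems.FrustratedLawDichotomyStrainedPatchHomForceJacN (forceJacCheckN)
open Summit.AtomisticToContinuum.Crystallization.Theorems.FrustratedLawDichotomyStrainedPatchHomForceHcp (xiBallOK)
open Summit.AtomisticToContinuum.Crystallization.Theorems.FrustratedLawDichotomyStrainedPatchHomSlopeLJ
open Summit.AtomisticToContinuum.Crystallization.Theorems.FrustratedLawDichotomyStrainedPatchHomSlopeLJAffine
open Summit.AtomisticToContinuum.Crystallization.Theorems.FrustratedLawDichotomyStrainedPatchHomSlopeLJAffine2Kit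

/-- Per-label precomputed data: the record on the hull box and the `w_b` table. -/
structure LabA2 where
  /-- label record (`recLJ`) -/
  L : CenLabel
  /-- `w_b` components -/
  W : Fin 3 → FI

/-- The record of a label. -/
def labA2 (c w' : (Fin 3 × Fin 3) ⊕ Fin 3 → ℤ) (b : Fin 3 → ℤ) : LabA2 := ⟨recLJ c w' b, fun l => wVec c b l⟩

/-- ★ THE SHARED LIST of label records. -/
def recsA2 (c w : (Fin 3 × Fin 3) ⊕ Fin 3 → ℤ) (J : Fin 3 → Fin 3 × Fin 3 → ℤ) (Lc : List (Fin 3 → ℤ)) : List LabA2 := Lc.map (labA2 c (hullW J w))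

/-- `T0` over the shared list. -/
def T0L (rs : List LabA2) (k k' i : Fin 3) : FI := lsum (rs.map fun r => Darr r.L k k' i)
/-- `W1` over the shared list. -/
def W1L (rs : List LabA2) (l k k' i : Fin 3) : FI := lsum (rs.map fun r => (r.W l).mul (Darr r.L k k' i))
/-- `W2` over the shared list. -/
def W2L (rs : List LabA2) (l l' k k' i : Fin 3) : FI := lsum (rs.map fun r => (r.W l).mul ((r.W l').mul (Darr r.L k k' i)))
/-- The quadratic array over the shared list. -/
def QarrL (c : (Fin 3 × Fin 3) ⊕ Fin 3 → ℤ) (J : Fin 3 → Fin 3 × Fin 3 → ℤ) (rs : List LabA2) (i : Fin 3) (a a' : Fin 3 × Fin 3) : FI :=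
  (((W2L rs a.2 a'.2 a.1 a'.1 i).add (sum3 fun k' => (cJ c J k' a').mul (W1L rs a.2 a.1 k' i))).add
    (sum3 fun k => (cJ c J k a).mul (W1L rs a'.2 k a'.1 i))).add
    (sum9 fun k k' => (cJ c J k a).mul ((cJ c J k' a').mul (T0L rs k k' i)))
/-- `M`-table of a record. -/
def MfiL (c : (Fin 3 × Fin 3) ⊕ Fin 3 → ℤ) (J : Fin 3 → Fin 3 × Fin 3 → ℤ) (r : LabA2) (k : Fin 3) (a : Fin 3 × Fin 3) : FI :=
  if k = a.1 then (r.W a.2).add (cJ c J k a) else cJ c J k a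
/-- `mD` of a record. -/
def mDbL (c w : (Fin 3 × Fin 3) ⊕ Fin 3 → ℤ) (J : Fin 3 → Fin 3 × Fin 3 → ℤ) (r : LabA2) (k : Fin 3) : ℤ :=
  cdiv (∑ a : Fin 3 × Fin 3, (MfiL c J r k a).absHi * w (Sum.inl a)) SC
/-- `resQ` over the shared list. -/
def resQL (c w : (Fin 3 × Fin 3) ⊕ Fin 3 → ℤ) (J : Fin 3 → Fin 3 × Fin 3 → ℤ) (rs : List LabA2) (i : Fin 3) : ℤ :=
  (rs.map fun r => ∑ k : Fin 3, ∑ k' : Fin 3,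
    cdiv ((mDbL c w J r k * ubA J w k' + ubA J w k * mDbL c w J r k' + ubA J w k * ubA J w k') * (Darr r.L k k' i).absHi) SC).sum
/-- `quadVec2` over the shared list. -/
def quadVec2L (c w : (Fin 3 × Fin 3) ⊕ Fin 3 → ℤ) (J : Fin 3 → Fin 3 × Fin 3 → ℤ) (rs : List LabA2) (i : Fin 3) : ℤ :=
  cdiv (∑ a : Fin 3 × Fin 3, ∑ a' : Fin 3 × Fin 3, cdiv (w (Sum.inl a) * w (Sum.inl a')) SC * (QarrL c J rs i a a').absHi + resQL c w J rs i) (2 * SC)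
/-- `quadL2` over the shared list. -/
def quadL2L (c w : (Fin 3 × Fin 3) ⊕ Fin 3 → ℤ) (J : Fin 3 → Fin 3 × Fin 3 → ℤ) (rs : List LabA2) : ℤ :=
  (FI.sqrt ⟨0, cdiv (∑ i : Fin 3, quadVec2L c w J rs i ^ 2) SC⟩).hi
/-- ★ The second-order affine slope constant from ONE shared record list. -/
def slopeGsLJA2L (c w : (Fin 3 × Fin 3) ⊕ Fin 3 → ℤ) (J : Fin 3 → Fin 3 × Fin 3 → ℤ) (Lc Ln : List (Fin 3 → ℤ)) : ℤ :=
  let rs := recsA2 c w J Lc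
  g0LJ c Lc + linLJA c w J Lc + quadL2L c w J rs + rem3LJ c (hullW J w) Lc + naiSLJ c (hullW J w) Ln

/-- `T0L = T0arr`. [formal bookkeeping] -/
theorem T0L_eq (c w : (Fin 3 × Fin 3) ⊕ Fin 3 → ℤ) (J : Fin 3 → Fin 3 × Fin 3 → ℤ) (Lc : List (Fin 3 → ℤ)) (k k' i : Fin 3) :
    T0L (recsA2 c w J Lc) k k' i = T0arr c (hullW J w) Lc k k' i := by
  simp only [T0L, T0arr, recsA2, accFI, List.map_map]; rfl
/-- `W1L = W1arr`. [formal bookkeeping] -/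
theorem W1L_eq (c w : (Fin 3 × Fin 3) ⊕ Fin 3 → ℤ) (J : Fin 3 → Fin 3 × Fin 3 → ℤ) (Lc : List (Fin 3 → ℤ)) (l k k' i : Fin 3) :
    W1L (recsA2 c w J Lc) l k k' i = W1arr c (hullW J w) Lc l k k' i := by
  simp only [W1L, W1arr, recsA2, accFI, List.map_map]; rfl
/-- `W2L = W2arr`. [formal bookkeeping] -/
theorem W2L_eq (c w : (Fin 3 × Fin 3) ⊕ Fin 3 → ℤ) (J : Fin 3 → Fin 3 × Fin 3 → ℤ) (Lc : List (Fin 3 → ℤ)) (l l' k k' i : Fin 3) :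
    W2L (recsA2 c w J Lc) l l' k k' i = W2arr c (hullW J w) Lc l l' k k' i := by
  simp only [W2L, W2arr, recsA2, accFI, List.map_map]; rfl
/-- `QarrL = QarrLJA2F`. [formal bookkeeping] -/
theorem QarrL_eq (c w : (Fin 3 × Fin 3) ⊕ Fin 3 → ℤ) (J : Fin 3 → Fin 3 × Fin 3 → ℤ) (Lc : List (Fin 3 → ℤ)) (i : Fin 3) (a a' : Fin 3 × Fin 3) :
    QarrL c J (recsA2 c w J Lc) i a a' = QarrLJA2F c w J Lc i a a' := by
  simp only [QarrL, QarrLJA2F, T0L_eq, W1L_eq, W2L_eq]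
/-- `resQL = resQ`. [formal bookkeeping] -/
theorem resQL_eq (c w : (Fin 3 × Fin 3) ⊕ Fin 3 → ℤ) (J : Fin 3 → Fin 3 × Fin 3 → ℤ) (Lc : List (Fin 3 → ℤ)) (i : Fin 3) :
    resQL c w J (recsA2 c w J Lc) i = resQ c w J Lc i := by
  simp only [resQL, resQ, recsA2, List.map_map]; rfl
/-- `quadVec2L = quadVec2F`. [formal bookkeeping] -/
theorem quadVec2L_eq (c w : (Fin 3 × Fin 3) ⊕ Fin 3 → ℤ) (J : Fin 3 → Fin 3 × Fin 3 → ℤ) (Lc : List (Fin 3 → ℤ)) (i : Fin 3) :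
    quadVec2L c w J (recsA2 c w J Lc) i = quadVec2F c w J Lc i := by
  simp only [quadVec2L, quadVec2F, QarrL_eq, resQL_eq]
/-- `slopeGsLJA2L = slopeGsLJA2F`. [formal bookkeeping] -/
theorem slopeGsLJA2L_eq (c w : (Fin 3 × Fin 3) ⊕ Fin 3 → ℤ) (J : Fin 3 → Fin 3 × Fin 3 → ℤ) (Lc Ln : List (Fin 3 → ℤ)) :
    slopeGsLJA2L c w J Lc Ln = slopeGsLJA2F c w J Lc Ln := by
  simp only [slopeGsLJA2L, slopeGsLJA2F, quadL2L, quadL2F, quadVec2L_eq]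

/-- The chunk slope constant from the shared list. -/
def htGsA2L (c w : (Fin 3 × Fin 3) ⊕ Fin 3 → ℤ) (J : Fin 3 → Fin 3 × Fin 3 → ℤ) (L : List (Fin 3 → ℤ)) : ℤ :=
  slopeGsLJA2L c w J (htScA2F c w J L) (htSnA2F c w J L)
/-- `htGsA2L = htGsA2F`. [formal bookkeeping] -/
theorem htGsA2L_eq (c w : (Fin 3 × Fin 3) ⊕ Fin 3 → ℤ) (J : Fin 3 → Fin 3 × Fin 3 → ℤ) (L : List (Fin 3 → ℤ)) :
    htGsA2L c w J L = htGsA2F c w J L := by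
  simp only [htGsA2L, htGsA2F, slopeGsLJA2L_eq]
/-- The fused certificate side computed from the shared list (kernel form). -/
def htCertSideA2L (p : HTCert) (J : Fin 3 → Fin 3 × Fin 3 → ℤ) (c w : (Fin 3 × Fin 3) ⊕ Fin 3 → ℤ) : Bool :=
  xiBallOK c w && jacOK J w && htROKU c w && htCertOKU p c w &&
    curvCheckLJM c w (htCenU c w) (htNaiU c w) p.D p.lam₁ && forceJacCheckN c w (htFar1U c w) p.lam₂ && forceJacCheckN c w (htFar2U c w) p.lam₃ &&
    (htNaiOKA2F c w J (htNearU c w) && htNaiOKNA c w J (htFar1U c w) && htNaiOKNA c w J (htFar2U c w)) &&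
    decide (htGsA2L c w J (htNearU c w) + htGsNA c w J (htFar1U c w) + htGsNA c w J (htFar2U c w) ≤ p.Gs)
/-- ★ `htCertSideA2F = htCertSideA2L` — a kernel `decide` on the shared-list form certifies the leaf's certificate side. [formal bookkeeping] -/
theorem htCertSideA2F_eq_L (p : HTCert) (J : Fin 3 → Fin 3 × Fin 3 → ℤ) (c w : (Fin 3 × Fin 3) ⊕ Fin 3 → ℤ) :
    htCertSideA2F p J c w = htCertSideA2L p J c w := by
  simp only [htCertSideA2F, htCertSideA2L, htGsA2L_eq]

end Summit.AtomisticToContinuum.Crystallization.Theorems.FrustratedLawDichotomyStrainedPatchHomEntryLeafHT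

end
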